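import Literature.Barriers.CriticalPhenomena.LongRangeTransitionBounds
import HarnessLib

/-!
# The `1/|x-y|²` family: Duminil-Copin–Garban–Tassion's renormalisation inequality (Lemma 2)

Proofs-only companion of `Literature.Barriers.CriticalPhenomena.LongRangeDiscontinuity`, third
step of the discharge of `NewmanSchulman1986_transition`: the summation over the position `i` of
the isolated bad block and the choice of `C₀`, turning the single-`i` estimate
`real_isolBad_inter_bad_le` and the two-bad-blocks bound `real_twoBad_le`
(`LongRangeTransitionBounds.lean`) into the renormalisation inequality of
Duminil-Copin–Garban–Tassion 2024, Lemma 2: "Let `β > 1` and `θ_∞ ∈ (3/4, 1)` satisfying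
`θ_∞² β > 1`. There exist `C₀ ≥ 1` … such that … for every `λ > 0`, `θ ≥ θ_∞`, and for every
integers `C ≥ C₀` and `K ≥ 2`,
`p_{β,λ}(CK, θ - C₀/C) ≤ (1/100) p_{β,λ}(K, θ) + 2C² p_{β,λ}(K, θ)²`."

Our rendering `renormalisation_inequality`: with `p(K, θ) = P[B^0_K is θ-bad]` (all blocks have
the same probability of being bad, `longRangePercolation_real_bad_eq`), for every `θ ∈ [θ_∞, 1]`,
`C ≥ C₀`, `K ≥ 1`: `p(CK, θ - C₀/C) ≤ p(K,θ)/100 + 4C² p(K,θ)²` — the constant `4` instead of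
`2` comes from bounding the number of pairs of blocks by `(2C-1)²` rather than `binom(2C-1,2)`,
and is immaterial for Thm. 1(i); `β ≥ 0` suffices here (the hypothesis `β θ_∞² > 1` is what is
used), and `θ ≤ 1` is implicit in the source (`θ ≤ θ₁ < 1`).

## References

* H. Duminil-Copin, C. Garban, V. Tassion, *Long-range models in 1D revisited*, AIHP 60 (2024)
  232–241, arXiv:2011.04642: §2.3, Lemma 2 (proof: (2.4)–(2.9) and the choice of `C₀`).
-/

noncomputable section

open scoped Classical

namespace Literature.Barriers.CriticalPhenomena

open _root_.MeasureTheory Finset unitInterval Literature.Probability.LatticeModels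
  Literature.Probability.Percolation
open scoped ENNReal

/-- The conditional bound in closed form: for `0 < θ₀ ≤ θ`, `γ = β θ₀²`,
`exp(-β θ² Λ_N) ≤ e^γ 3^γ (N+3)^{-γ}` (from `Λ_N ≥ log((N+3)/3) - 1`, `log_sub_one_le_pairSum`).
[cite: DuminilcopinGarbanTassion2024, §2.3 (proof of Lemma 2, (2.8)–(2.9))] -/
theorem exp_neg_pairSum_le {β θ θ₀ : ℝ} (hβ : 0 ≤ β) (hθ₀ : 0 < θ₀) (hθ : θ₀ ≤ θ) (N : ℕ) :
    Real.exp (-(β * θ ^ 2 * ∑ m ∈ range N, ∑ m' ∈ range N, 1 / ((3 : ℝ) + m + m') ^ 2)) ≤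
      Real.exp (β * θ₀ ^ 2) * (3 : ℝ) ^ (β * θ₀ ^ 2) * ((N : ℝ) + 3) ^ (-(β * θ₀ ^ 2)) := by
  set γ := β * θ₀ ^ 2 with hγ
  set Λ := ∑ m ∈ range N, ∑ m' ∈ range N, 1 / ((3 : ℝ) + m + m') ^ 2 with hΛ
  set ℓ := Real.log (((N : ℝ) + 3) / 3) - 1 with hℓ
  have hΛ0 : 0 ≤ Λ := sum_nonneg fun _ _ => sum_nonneg fun _ _ => by positivity
  have hℓΛ : ℓ ≤ Λ := log_sub_one_le_pairSum N
  have hγ0 : 0 ≤ γ := by positivity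
  have hγθ : γ ≤ β * θ ^ 2 := by
    rw [hγ]; exact mul_le_mul_of_nonneg_left (pow_le_pow_left₀ hθ₀.le hθ 2) hβ
  -- `γ ℓ ≤ β θ² Λ`
  have key : γ * ℓ ≤ β * θ ^ 2 * Λ := by
    rcases le_or_gt ℓ 0 with h | h
    · exact (mul_nonpos_of_nonneg_of_nonpos hγ0 h).trans (mul_nonneg (by positivity) hΛ0)
    · calc γ * ℓ ≤ β * θ ^ 2 * ℓ := mul_le_mul_of_nonneg_right hγθ h.le
        _ ≤ β * θ ^ 2 * Λ := mul_le_mul_of_nonneg_left hℓΛ (by positivity)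
  have hN3 : (0 : ℝ) < (N : ℝ) + 3 := by positivity
  calc Real.exp (-(β * θ ^ 2 * Λ)) ≤ Real.exp (-(γ * ℓ)) := Real.exp_le_exp.2 (by linarith)
    _ = Real.exp γ * (3 : ℝ) ^ γ * ((N : ℝ) + 3) ^ (-γ) := by
        rw [hℓ, Real.log_div hN3.ne' (by norm_num), Real.rpow_def_of_pos hN3,
          Real.rpow_def_of_pos (by norm_num : (0 : ℝ) < 3), ← Real.exp_add, ← Real.exp_add]
        congr 1; ring

/-- On integers of absolute value `< C`, the map `i ↦ C - |i|` takes each value at most twice.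
[folklore] -/
theorem card_filter_sub_natAbs_le (C : ℕ) {s : Finset ℤ} (hs : ∀ i ∈ s, i.natAbs < C) (m : ℕ) :
    (s.filter fun i : ℤ => C - i.natAbs = m).card ≤ 2 := by
  have hsub : (s.filter fun i : ℤ => C - i.natAbs = m) ⊆ {((C - m : ℕ) : ℤ), -((C - m : ℕ) : ℤ)} := by
    intro i hi
    rw [Finset.mem_filter] at hi
    obtain ⟨his, hi⟩ := hi
    have := hs i his
    rw [Finset.mem_insert, Finset.mem_singleton]
    omega
  exact (Finset.card_le_card hsub).trans Finset.card_le_two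

/-- Comparison of the two scales: `(N_i + 3)^{-γ} ≤ 2^γ (C - |i|)^{-γ}` for
`N_i = ⌊(C - |i| - 1)/2⌋`, `0 < C - |i|`, `γ ≥ 0`. [folklore] -/
theorem rpow_halfIndex_le {γ : ℝ} (hγ : 0 ≤ γ) {C a : ℕ} (ha : a < C) :
    (((C - a - 1) / 2 : ℕ) + 3 : ℝ) ^ (-γ) ≤ (2 : ℝ) ^ γ * ((C - a : ℕ) : ℝ) ^ (-γ) := by
  have hpos : (0 : ℝ) < ((C - a : ℕ) : ℝ) / 2 := by
    have : 0 < C - a := Nat.sub_pos_of_lt ha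
    positivity
  have hle : ((C - a : ℕ) : ℝ) / 2 ≤ (((C - a - 1) / 2 : ℕ) : ℝ) + 3 := by
    have h1 : (C - a : ℕ) ≤ 2 * ((C - a - 1) / 2) + 2 := by omega
    have h2 : ((C - a : ℕ) : ℝ) ≤ 2 * (((C - a - 1) / 2 : ℕ) : ℝ) + 2 := by exact_mod_cast h1
    linarith
  calc (((C - a - 1) / 2 : ℕ) + 3 : ℝ) ^ (-γ) ≤ (((C - a : ℕ) : ℝ) / 2) ^ (-γ) :=
        Real.rpow_le_rpow_of_nonpos hpos hle (by linarith)
    _ = (2 : ℝ) ^ γ * ((C - a : ℕ) : ℝ) ^ (-γ) := by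
        rw [Real.div_rpow (Nat.cast_nonneg _) (by norm_num), Real.rpow_neg (by norm_num : (0:ℝ) ≤ 2),
          div_inv_eq_mul, mul_comm]

/-- **Renormalisation inequality** (Duminil-Copin–Garban–Tassion 2024, Lemma 2): for `β ≥ 0` and
`θ₀ ∈ (3/4, 1]`... with `β θ₀² > 1` there is `C₀ ≥ 3` such that for all `p`, all `θ ∈ [θ₀, 1]`,
all `K ≥ 1` and `C ≥ C₀`: if every `K`-block is `θ`-bad with probability `≤ u`, then
`P[B_{CK} is (θ - C₀/C)-bad] ≤ u/100 + 4 C² u²`. Proof as printed: covering lemma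
(`bad_mul_subset`), union bound, `real_twoBad_le`, and `Σ_{|i| ≤ C-C₀} ℙ[F_i] ≤ u Σ_i e^γ 3^γ
(N_i+3)^{-γ} ≤ u 2^γ e^γ 3^γ Σ_i (C-|i|)^{-γ} ≤ u/100` once `C₀` is so large that the tail
of `Σ m^{-γ}` beyond `C₀` is small (`exists_forall_sum_rpow_neg_le`; each value `C - |i|` is taken
at most twice).
[cite: DuminilcopinGarbanTassion2024, Lemma 2 (§2.3)] -/
theorem renormalisation_inequality (β : ℝ) (hβ : 0 ≤ β) {θ₀ : ℝ} (hθ₀ : 3 / 4 < θ₀)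
    (hγ : 1 < β * θ₀ ^ 2) :
    ∃ C₀ : ℕ, 3 ≤ C₀ ∧ ∀ (p : unitInterval) (θ : ℝ), θ₀ ≤ θ → θ ≤ 1 → ∀ (K C : ℕ), 1 ≤ K → C₀ ≤ C →
      ∀ u : ℝ, (∀ j : ℤ, (longRangePercolation (anFamily β hβ p)).real (bad K θ j) ≤ u) →
        (longRangePercolation (anFamily β hβ p)).real (bad (C * K) (θ - C₀ / C) 0) ≤
          u / 100 + 4 * (C : ℝ) ^ 2 * u ^ 2 := by
  set γ := β * θ₀ ^ 2 with hγdef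
  set c : ℝ := Real.exp γ * (3 : ℝ) ^ γ with hc
  have hc0 : 0 < c := by positivity
  have hγ0 : 0 ≤ γ := by positivity
  obtain ⟨M, hM⟩ := exists_forall_sum_rpow_neg_le hγ (ε := 1 / (200 * c * 2 ^ γ)) (by positivity)
  refine ⟨max 3 M, le_max_left _ _, ?_⟩
  intro p θ hθ₀θ hθ1 K C hK hC u hu
  set C₀ := max 3 M with hC₀
  set μ := longRangePercolation (anFamily β hβ p) with hμ
  haveI : IsProbabilityMeasure μ := instIsProbabilityMeasureLongRangePercolation _
  have hθ : 3 / 4 < θ := by linarith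
  have hu0 : 0 ≤ u := measureReal_nonneg.trans (hu 0)
  have hC₀3 : 3 ≤ C₀ := le_max_left _ _
  have hC1 : 1 ≤ C := by omega
  set J : ℤ := (C : ℤ) - C₀ with hJ
  set Fi : ℤ → Set (BondConfig ℤ) := fun i => isolBad K θ C i ∩ bad (C * K) (θ - C₀ / C) 0 with hFi
  -- covering and union bound
  have hcov := bad_mul_subset hK hθ hθ1 hC hC1 (C₀ := C₀)
  have h1 : μ.real (bad (C * K) (θ - C₀ / C) 0) ≤
      μ.real (twoBad K θ C) + ∑ i ∈ Finset.Icc (-J) J, μ.real (Fi i) :=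
    calc μ.real (bad (C * K) (θ - C₀ / C) 0)
        ≤ μ.real (twoBad K θ C ∪ ⋃ i ∈ Finset.Icc (-J) J, Fi i) := measureReal_mono hcov (measure_ne_top μ _)
      _ ≤ μ.real (twoBad K θ C) + μ.real (⋃ i ∈ Finset.Icc (-J) J, Fi i) := measureReal_union_le _ _
      _ ≤ μ.real (twoBad K θ C) + ∑ i ∈ Finset.Icc (-J) J, μ.real (Fi i) := by
          gcongr; exact measureReal_biUnion_finset_le _ _
  -- the single-`i` estimates
  set ψ : ℤ → ℕ := fun i => C - i.natAbs with hψ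
  have h2 : ∀ i ∈ Finset.Icc (-J) J, μ.real (Fi i) ≤ c * u * 2 ^ γ * ((ψ i : ℕ) : ℝ) ^ (-γ) := by
    intro i hi
    rw [Finset.mem_Icc] at hi
    have habs : (i.natAbs : ℤ) ≤ (C : ℤ) - C₀ := by
      rw [Int.natCast_natAbs]; exact abs_le.2 ⟨hi.1, hi.2⟩
    set N : ℕ := (C - i.natAbs - 1) / 2 with hN
    have hN2 : 2 * (N : ℤ) ≤ (C : ℤ) - |i| - 1 := by
      rw [Int.abs_eq_natAbs]; omega
    have hle := real_isolBad_inter_bad_le β hβ p hK hθ hθ1 hC₀3 hi.1 hi.2 hN2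
    have hq := exp_neg_pairSum_le hβ (by linarith) hθ₀θ N (β := β) (θ := θ)
    have hcmp : ((N : ℝ) + 3) ^ (-γ) ≤ (2 : ℝ) ^ γ * ((ψ i : ℕ) : ℝ) ^ (-γ) := by
      have := rpow_halfIndex_le hγ0 (C := C) (a := i.natAbs) (by omega)
      rw [← hN] at this
      exact this
    calc μ.real (Fi i) ≤ _ := hle
      _ ≤ c * ((N : ℝ) + 3) ^ (-γ) * u := by
          rw [hc]
          exact mul_le_mul hq (hu i) measureReal_nonneg (by positivity)
      _ ≤ c * ((2 : ℝ) ^ γ * ((ψ i : ℕ) : ℝ) ^ (-γ)) * u := by gcongr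
      _ = c * u * 2 ^ γ * ((ψ i : ℕ) : ℝ) ^ (-γ) := by ring
  -- summing over `i`: fibres of size ≤ 2 and the tail of `Σ m^{-γ}`
  have h3 : ∑ i ∈ Finset.Icc (-J) J, ((ψ i : ℕ) : ℝ) ^ (-γ) ≤ 2 * (1 / (200 * c * 2 ^ γ)) := by
    calc ∑ i ∈ Finset.Icc (-J) J, ((ψ i : ℕ) : ℝ) ^ (-γ)
        ≤ (2 : ℕ) * ∑ m ∈ (Finset.Icc (-J) J).image ψ, ((m : ℕ) : ℝ) ^ (-γ) :=
          sum_le_mul_sum_image_of_card_fiber_le _ ψ (fun m : ℕ => ((m : ℕ) : ℝ) ^ (-γ))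
            (fun m => by positivity) 2 (fun m _ => card_filter_sub_natAbs_le C (fun i hi => by
              rw [Finset.mem_Icc] at hi
              have : (i.natAbs : ℤ) ≤ (C : ℤ) - C₀ := by
                rw [Int.natCast_natAbs]; exact abs_le.2 ⟨hi.1, hi.2⟩
              omega) m)
      _ ≤ (2 : ℕ) * (1 / (200 * c * 2 ^ γ)) := by
          gcongr
          refine hM _ fun m hm => ?_
          rw [Finset.mem_image] at hm
          obtain ⟨i, hi, rfl⟩ := hm
          rw [Finset.mem_Icc] at hi
          have habs : (i.natAbs : ℤ) ≤ (C : ℤ) - C₀ := by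
            rw [Int.natCast_natAbs]; exact abs_le.2 ⟨hi.1, hi.2⟩
          have : M ≤ C₀ := le_max_right _ _
          show M ≤ C - i.natAbs
          omega
      _ = 2 * (1 / (200 * c * 2 ^ γ)) := by norm_num
  have h4 : ∑ i ∈ Finset.Icc (-J) J, μ.real (Fi i) ≤ u / 100 :=
    calc ∑ i ∈ Finset.Icc (-J) J, μ.real (Fi i)
        ≤ ∑ i ∈ Finset.Icc (-J) J, c * u * 2 ^ γ * ((ψ i : ℕ) : ℝ) ^ (-γ) := sum_le_sum h2
      _ = c * u * 2 ^ γ * ∑ i ∈ Finset.Icc (-J) J, ((ψ i : ℕ) : ℝ) ^ (-γ) := by rw [mul_sum]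
      _ ≤ c * u * 2 ^ γ * (2 * (1 / (200 * c * 2 ^ γ))) := mul_le_mul_of_nonneg_left h3 (by positivity)
      _ = u / 100 := by field_simp; ring
  have h5 := real_twoBad_le (anFamily β hβ p) K θ C hu
  linarith

end Literature.Barriers.CriticalPhenomena

end
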